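import Literature.NumberTheory.EllipticCurves.ProfiniteGroupDistributionInduceFromSubgroup
import HarnessLib

/-!
# Bounded distributions on a group along a subgroup tower: the DIVISION DATA of de Shalit II.4.12 transported
# from the restricted tower on `H` to `Γ` (orders, generation, membership), and II.4.12 on `Γ` with `H`-currency data

Topic `NumberTheory/EllipticCurves`; namespace `Literature.NumberTheory.EllipticCurves.GroupDistribution`.

Sequel of `ProfiniteGroupDistributionInduceFromSubgroup.lean` (`induceFrom`: de Shalit's induction of an
`H`-equivariant measure family from `H ≤ Γ` to `Γ`, and `exists_twisting_μ_eq_forall_induceFrom` = II.4.12 on `Γ`).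
The division hypotheses of II.4.12 (`σ_{𝔞₁}` topologically generates `U_s`, `p`-power orders unbounded along the
tower, `σ_{𝔞₂}^k σ_{𝔞₁}^{-k} ∉ ⋂ U_n`) concern two auxiliary Artin symbols which DO lie in `H = Gal(K̄/K(𝔪))`
(`𝔞ᵢ = (αᵢ)`, `αᵢ ≡ 1 mod 𝔪`), and the tree discharges them in the currency of the RESTRICTED tower `𝒱` on `H`
(`RayClassFieldAdicCharacterDivision.lean`: `hgen_artin`, `hpow_artin`, `hunb_artin`, `hτ_artin` for `rayAdicTower`).
THIS file transports them to `Γ`: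

* §1 `quotientMap_subtype_injective` — the group map `H ⧸ V_n ↪ Γ ⧸ U_n` (`V_n = U_n ∩ H`) is injective,
  `orderOf_proj_coe` (orders of cells agree), `hgen_of_subgroup`, `hpow_of_subgroup`, `hunb_of_subgroup`,
  `hτ_of_subgroup`, `mem_U_coe_iff`;
* §2 ★★ `exists_twisting_μ_eq_forall_induceFrom_of_subgroup_data` — II.4.12 ON `Γ` (`δ_{σ_𝔠,N𝔠} E = induceFrom i_H (β_𝔠)`
  for all `𝔠`, `σ_𝔠 ∈ Γ` arbitrary) from division data stated for `σ_{𝔞₁}, σ_{𝔞₂} ∈ H` in the restricted tower —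
  exactly the shape the one-`𝔓` assembly (`…EllipticUnitsLocal.exists_groupDistribution_twisting_eq_induce_ellipticUnitsLocal`)
  consumes, so the same dischargers serve.

Everything is a theorem; no named facts, no definitions, no instances, no `sorry`.

## References

* [deShalit1987] E. de Shalit, *Iwasawa theory of elliptic curves with complex multiplication* (1987), II.4.12
  (p. 66–69), I.3.4 (p. 18).
-/

noncomputable section

open Filter
open scoped Topology Classical

namespace Literature.NumberTheory.EllipticCurves

namespace GroupDistribution

variable {Γ : Type*} [Group Γ] {H : Subgroup Γ} {𝒰 : SubgroupTower Γ} {𝒱 : SubgroupTower H}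
  [∀ n, (𝒰.U n).Normal] [∀ n, (𝒱.U n).Normal] (hV : ∀ n, 𝒱.U n = (𝒰.U n).subgroupOf H)

/-! ### §1. `H ⧸ V_n ↪ Γ ⧸ U_n` and the transport of orders, generation and membership -/

omit [∀ n, (𝒰.U n).Normal] [∀ n, (𝒱.U n).Normal] in
include hV in
/-- Membership dictionary: `h ∈ V_n ↔ (h : Γ) ∈ U_n`. [cite: deShalit1987, I.3.4 (p. 18)] -/
theorem mem_U_coe_iff (n : ℕ) (h : H) : (h : Γ) ∈ 𝒰.U n ↔ h ∈ 𝒱.U n := by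
  rw [hV n, Subgroup.mem_subgroupOf]

include hV in
/-- The group map `H ⧸ V_n → Γ ⧸ U_n` induced by the inclusion is injective (`V_n = U_n ∩ H`).
[cite: deShalit1987, I.3.4 (p. 18)] -/
theorem quotientMap_subtype_injective (n : ℕ) :
    Function.Injective (QuotientGroup.map (𝒱.U n) (𝒰.U n) H.subtype (le_comap_subtype_of_eq_subgroupOf hV n)) := by
  intro a b hab
  obtain ⟨x, rfl⟩ := QuotientGroup.mk_surjective a
  obtain ⟨y, rfl⟩ := QuotientGroup.mk_surjective b
  exact (proj_coe_eq_iff hV).mp hab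

include hV in
/-- ★ **Orders of cells agree**: `orderOf (x U_n) = orderOf (x V_n)` for `x ∈ H` (the cell map `H ⧸ V_n ↪ Γ ⧸ U_n` is an
injective group map). [cite: deShalit1987, II.4.12 (p. 68)] -/
theorem orderOf_proj_coe (n : ℕ) (x : H) : orderOf (𝒰.proj n (x : Γ)) = orderOf (𝒱.proj n x) := by
  have h : QuotientGroup.map (𝒱.U n) (𝒰.U n) H.subtype (le_comap_subtype_of_eq_subgroupOf hV n) (𝒱.proj n x) =
      𝒰.proj n (x : Γ) := rfl
  rw [← h]
  exact orderOf_injective _ (quotientMap_subtype_injective hV n) _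

omit [∀ n, (𝒰.U n).Normal] [∀ n, (𝒱.U n).Normal] in
include hV in
/-- **`hgen` transported**: if `g ∈ H` generates `V_s` modulo every `V_m` (`s ≤ m`) and `U_s ≤ H`, then `g` generates
`U_s` modulo every `U_m`. [cite: deShalit1987, II.4.12 (p. 66–68)] -/
theorem hgen_of_subgroup {s : ℕ} (hHs : 𝒰.U s ≤ H) (g : H)
    (hgen : ∀ m, s ≤ m → ∀ u ∈ 𝒱.U s, ∃ k : ℕ, 𝒱.proj m (g ^ k) = 𝒱.proj m u) :
    ∀ m, s ≤ m → ∀ w ∈ 𝒰.U s, ∃ k : ℕ, 𝒰.proj m ((g : Γ) ^ k) = 𝒰.proj m w := by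
  intro m hm w hw
  obtain ⟨k, hk⟩ := hgen m hm ⟨w, hHs hw⟩ ((mem_U_coe_iff hV s ⟨w, hHs hw⟩).mp hw)
  refine ⟨k, ?_⟩
  have h := (proj_coe_eq_iff hV).mpr hk
  rwa [Subgroup.coe_pow] at h

include hV in
/-- **`hpow` transported**: `p`-power orders of the cells of `g ∈ H` read in `Γ`. [cite: deShalit1987, II.4.12 (p. 68)] -/
theorem hpow_of_subgroup {p s : ℕ} (g : H)
    (hpow : ∀ n, s ≤ n → ∃ e : ℕ, orderOf (𝒱.proj n g) = p ^ e) :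
    ∀ n, s ≤ n → ∃ e : ℕ, orderOf (𝒰.proj n (g : Γ)) = p ^ e := by
  intro n hn
  rw [orderOf_proj_coe hV]
  exact hpow n hn

include hV in
/-- **`hunb` transported**: unbounded `p`-power orders along the tower, read in `Γ`. [cite: deShalit1987, II.4.12 (p. 68)] -/
theorem hunb_of_subgroup {p : ℕ} (g : H)
    (hunb : ∀ e : ℕ, ∃ m, p ^ e ∣ orderOf (𝒱.proj m g)) :
    ∀ e : ℕ, ∃ m, p ^ e ∣ orderOf (𝒰.proj m (g : Γ)) := by
  intro e
  obtain ⟨m, hm⟩ := hunb e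
  exact ⟨m, by rwa [orderOf_proj_coe hV]⟩

omit [∀ n, (𝒰.U n).Normal] [∀ n, (𝒱.U n).Normal] in
include hV in
/-- **`hτ` transported**: `g₂^k g₁^{-k} ∉ V_n` iff the same element of `Γ` is `∉ U_n`. [cite: deShalit1987, II.4.12 (p. 68–69)] -/
theorem hτ_of_subgroup {s : ℕ} (g₁ g₂ : H)
    (hτ : ∀ k, 0 < k → ∃ n, s ≤ n ∧ g₂ ^ k * (g₁ ^ k)⁻¹ ∉ 𝒱.U n) :
    ∀ k, 0 < k → ∃ n, s ≤ n ∧ (g₂ : Γ) ^ k * ((g₁ : Γ) ^ k)⁻¹ ∉ 𝒰.U n := by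
  intro k hk
  obtain ⟨n, hn, h⟩ := hτ k hk
  refine ⟨n, hn, fun h' ↦ h ?_⟩
  rw [← mem_U_coe_iff hV n, Subgroup.coe_mul, Subgroup.coe_inv, Subgroup.coe_pow, Subgroup.coe_pow]
  exact h'

/-! ### §2. II.4.12 on `Γ` from division data in the restricted tower -/

section Division

open TwistingDiv

variable {p : ℕ} [hp : Fact p.Prime]
  {𝕜 : Type*} {B : Type*} [CommMonoid B] [MulDistribMulAction Γ B] {I : Type*}
  (iH : B → GroupDistribution 𝒱 ℂ_[p]) {C : ℝ} (hC0 : 0 ≤ C) (hC : ∀ b, (iH b).bound ≤ C)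
  (β : I → B) (σ : I → Γ) (Nm : I → ℕ)
  (hH : 𝒰.U 0 ≤ H)
  (hiH_smul : ∀ (h : H) (b : B) (n : ℕ) (a : H ⧸ 𝒱.U n),
    (iH ((h : Γ) • b)).μ n (𝒱.proj n h * a) = (iH b).μ n a)
  (hiH_mul : ∀ (b b' : B) (n : ℕ) (a : H ⧸ 𝒱.U n), (iH (b * b')).μ n a = (iH b).μ n a + (iH b').μ n a)
  (hrel : ∀ a c : I, σ c • β a * β c ^ Nm a = σ a • β c * β a ^ Nm c)

include hH hiH_smul hiH_mul hrel in
/-- ★★ **de Shalit II.4.12 ON `Γ` from division data in the RESTRICTED tower.**  As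
`exists_twisting_μ_eq_forall_induceFrom`, but the two auxiliary indices `𝔞₁, 𝔞₂` have lifts `σ_{𝔞ᵢ} ∈ H` and their
division data (`σ_{𝔞ᵢ} ∈ V_s`, `σ_{𝔞₁}` generating `V_s` modulo every `V_m`, `p`-power orders unbounded along `𝒱`,
`σ_{𝔞₂}^k σ_{𝔞₁}^{-k} ∉ ⋂ V_n`) are stated in the tower `𝒱` on `H` — the currency of the tree's dischargers
`hgen_artin` / `hpow_artin` / `hunb_artin` / `hτ_artin`.  Conclusion: a bounded `E` on `Γ` along `𝒰`, `‖E‖ ≤ C`, with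
`δ_{σ_𝔠, N𝔠} E = induceFrom i_H (β_𝔠)` levelwise for EVERY `𝔠 ∈ I` (`σ_𝔠 ∈ Γ` arbitrary).
[cite: deShalit1987, II.4.12 (29)–(33) (p. 66–69), I.3.4 (p. 18)] -/
theorem exists_twisting_μ_eq_forall_induceFrom_of_subgroup_data
    (hcomm : ∀ (n : ℕ) (x y : Γ), x * y * x⁻¹ * y⁻¹ ∈ 𝒰.U n)
    {s : ℕ} (a₁ a₂ : I) (hσ₁H : σ a₁ ∈ H) (hσ₂H : σ a₂ ∈ H)
    (hσ₁ : (⟨σ a₁, hσ₁H⟩ : H) ∈ 𝒱.U s) (hσ₂ : (⟨σ a₂, hσ₂H⟩ : H) ∈ 𝒱.U s)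
    (hgen : ∀ m, s ≤ m → ∀ u ∈ 𝒱.U s, ∃ k : ℕ, 𝒱.proj m ((⟨σ a₁, hσ₁H⟩ : H) ^ k) = 𝒱.proj m u)
    (hpow : ∀ n, s ≤ n → ∃ e : ℕ, orderOf (𝒱.proj n (⟨σ a₁, hσ₁H⟩ : H)) = p ^ e)
    (hunb : ∀ e : ℕ, ∃ m, p ^ e ∣ orderOf (𝒱.proj m (⟨σ a₁, hσ₁H⟩ : H)))
    (hN1 : 2 ≤ Nm a₁) (hpN : p ∣ Nm a₁ - 1) (h4 : p = 2 → 4 ∣ Nm a₁ - 1) (hN12 : Nm a₂ = Nm a₁)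
    (hτ : ∀ k, 0 < k → ∃ n, s ≤ n ∧
      (⟨σ a₂, hσ₂H⟩ : H) ^ k * ((⟨σ a₁, hσ₁H⟩ : H) ^ k)⁻¹ ∉ 𝒱.U n) :
    ∃ E : GroupDistribution 𝒰 ℂ_[p], E.bound = C ∧
      ∀ (c : I) (n : ℕ) (b : Γ ⧸ 𝒰.U n),
        (twisting (σ c) (Nm c : ℂ_[p]) E).μ n b = (induceFrom hV iH hC0 hC (β c)).μ n b := by
  have hHs : 𝒰.U s ≤ H := (𝒰.le_of_le (Nat.zero_le s)).trans hH
  exact exists_twisting_μ_eq_forall_induceFrom hV iH hC0 hC β σ Nm hH hiH_smul hiH_mul hrel hcomm a₁ a₂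
    ((mem_U_coe_iff hV s ⟨σ a₁, hσ₁H⟩).mpr hσ₁) ((mem_U_coe_iff hV s ⟨σ a₂, hσ₂H⟩).mpr hσ₂)
    (hgen_of_subgroup hV hHs ⟨σ a₁, hσ₁H⟩ hgen) (hpow_of_subgroup hV ⟨σ a₁, hσ₁H⟩ hpow)
    (hunb_of_subgroup hV ⟨σ a₁, hσ₁H⟩ hunb) hN1 hpN h4 hN12 (hτ_of_subgroup hV ⟨σ a₁, hσ₁H⟩ ⟨σ a₂, hσ₂H⟩ hτ)

end Division

end GroupDistribution

end Literature.NumberTheory.EllipticCurves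

end
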